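import Mathlib
import Literature.NumberTheory.Automorphic.ShimuraCurveAnalytic
import Literature.NumberTheory.Automorphic.ShimuraCurveFiniteVolume
import Literature.NumberTheory.Automorphic.HypFundamentalDomainVolume
import Literature.Analysis.Complex.LogNormLocallyIntegrable
import HarnessLib

/-!
# Proof of `shimuraCurve_pet_pos_ae_and_log_integrable`: a.e. positivity and `log`-integrability of
# the Petersson density `|h|² y²` on a compact Shimura curve

This file discharges, sorry-free, the named fact
`Literature.NumberTheory.Automorphic.shimuraCurve_pet_pos_ae_and_log_integrable`
(`ShimuraCurveAnalytic.lean`): for `D > 1`, a Shimura curve datum `X` of level `(D, M)` and a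
non-zero `h ∈ S₂(Γ₀^D(M))`, `|h(z)|² (Im z)² > 0` for a.e. `z ∈ X.fd` and
`log(|h(z)|² (Im z)²) ∈ L¹(X.fd, dx dy / y²)` (`shimuraCurve_pet_pos_ae_and_log_integrable_holds`).

## The argument (the fact's docstring, made formal)

1. The zeros of the holomorphic `h ≢ 0` on `ℍ` are countable (tree
   `countable_setOf_cuspForm_eq_zero`), hence null: a.e. positivity.
2. `u = |h|² y²` is `Γ`-invariant in weight `2` (Mathlib `SlashInvariantForm.slash_action_eqn''`,
   `UpperHalfPlane.im_smul_eq_div_normSq`).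
3. `Γ = ι(O¹)` is cocompact for `D > 1`: every orbit meets the compact hyperbolic ball
   `K = B̄(i, ρ)` (tree `ShimuraCurveData.exists_forall_exists_smul_mem_closedBall`,
   `ShimuraCurveFiniteVolume.lean`: `X.B` is a division algebra, Minkowski, finiteness of the
   elements of bounded reduced norm modulo `O¹`; Vignéras IV Thm. 1.1, Shimura Prop. 9.3).
4. `log u` is integrable on `K`: `integrableOn_log_normSq_mul_im_sq_of_isCompact` — on `ℂ ⊇ K`,
   `|log(|h|² y²)| ≤ 2 |log |h|| + 2 |log y|` with `log |h ∘ ofComplex|` integrable on compacts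
   (`Literature.Analysis.Complex.integrableOn_log_norm_of_isCompact`, Ransford Thm. 2.5.1 for the
   subharmonic `log |h|` of Thm. 2.2.2; the zeros of `h` are nowhere locally dense by the identity
   theorem on the connected `{Im > 0}`), `log y` continuous, and the density `y⁻²` bounded on `K`
   (tree `setLIntegral_eq_setLIntegral_image_coe`).
5. Transfer to the arbitrary measurable a.e. fundamental domain `X.fd` by the unfolding identity
   `∫_{fd} Σ_γ φ(γ w) dμ = 2 ∫_ℍ φ dμ` (tree `setLIntegral_tsum_smul_eq`) with `φ = 𝟙_K |log u|`:
   every orbit meets `K` and `u` is invariant, so `|log u(w)| ≤ Σ_γ φ(γ w)` and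
   `∫_{fd} |log u| ≤ 2 ∫_K |log u| < ∞`. (False for `D = 1`: at a cusp `log |h|² ∼ -4π y`.)

## References

* M.-F. Vignéras, *Arithmétique des algèbres de quaternions*, LNM 800 (1980), Ch. IV §1 Thm. 1.1
  (PDF p. 89). [VignerasLNM800]
* T. Ransford, *Potential Theory in the Complex Plane* (1995), Thm. 2.2.2 (PDF p. 24) and
  Thm. 2.5.1 (PDF p. 33). [Ransford1995]
* H. Iwaniec, *Spectral Methods of Automorphic Forms* (2002), §2.2 (unfolding). [Iwaniec2002]
-/

noncomputable section

open scoped MatrixGroups UpperHalfPlane Manifold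
open _root_.MeasureTheory Set Filter

namespace Literature.NumberTheory.Automorphic

open Literature.Analysis.Complex (integrableOn_log_norm_of_isCompact)

section LogIntegrable

open Metric _root_.Topology

/-- **`log(|f|² y²)` is integrable on compact subsets of `ℍ`** (hyperbolic measure) for a
holomorphic `f : ℍ → ℂ` which is not identically zero: on `ℂ ⊇ K`, `|log(|f|² y²)| ≤
2|log |f|| + 2|log y|` with `log |f ∘ ofComplex|` integrable (`integrableOn_log_norm_of_isCompact`;
the zeros of `f` are not locally dense by the identity theorem on the connected `{Im > 0}`) and
`log y` continuous; the density `y⁻²` of `dμ` is bounded on `K`. [folklore] -/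
theorem integrableOn_log_normSq_mul_im_sq_of_isCompact {f : ℍ → ℂ}
    (hf : MDifferentiable 𝓘(ℂ) 𝓘(ℂ) f) (hf0 : f ≠ 0) {K : Set ℍ} (hK : IsCompact K) :
    IntegrableOn (fun z : ℍ => Real.log (‖f z‖ ^ 2 * z.im ^ 2)) K := by
  set F : ℂ → ℂ := f ∘ UpperHalfPlane.ofComplex with hFdef
  set U : Set ℂ := {w | 0 < w.im} with hUdef
  have hU : IsOpen U := isOpen_lt continuous_const Complex.continuous_im
  have hFd : DifferentiableOn ℂ F U := UpperHalfPlane.mdifferentiable_iff.mp hf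
  have hF0 : ∀ x ∈ U, ¬ ∀ᶠ w in 𝓝 x, F w = 0 := by
    intro x hx hzero
    apply hf0
    have hEq := (hFd.analyticOnNhd hU).eqOn_zero_of_preconnected_of_eventuallyEq_zero
      (convex_halfSpace_im_gt 0).isPreconnected hx hzero
    funext τ
    have := hEq (show (τ : ℂ) ∈ U from τ.im_pos)
    simpa [hFdef, UpperHalfPlane.ofComplex_apply] using this
  set K' : Set ℂ := ((↑) : ℍ → ℂ) '' K with hK'def
  have hK' : IsCompact K' := hK.image UpperHalfPlane.continuous_coe
  have hK'U : K' ⊆ U := by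
    rintro _ ⟨τ, _, rfl⟩
    exact τ.im_pos
  have hlogF : IntegrableOn (fun w => Real.log ‖F w‖) K' :=
    integrableOn_log_norm_of_isCompact hU hFd hF0 hK' hK'U
  have hlogim : IntegrableOn (fun w : ℂ => Real.log w.im) K' :=
    ContinuousOn.integrableOn_compact hK'
      (Complex.continuous_im.continuousOn.log fun w hw => (hK'U hw).ne')
  -- the `ℂ`-side integrand
  have hFc : ContinuousOn F K' := hFd.continuousOn.mono hK'U
  have hUint : IntegrableOn (fun w => Real.log (‖F w‖ ^ 2 * w.im ^ 2)) K' := by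
    refine Integrable.mono' ((hlogF.norm.const_mul 2).add (hlogim.norm.const_mul 2)) ?_ ?_
    · exact (Real.measurable_log.comp_aemeasurable
        (((hFc.norm.pow 2).mul ((Complex.continuous_im.continuousOn).pow 2)).aemeasurable
          hK'.measurableSet)).aestronglyMeasurable
    · refine ae_restrict_of_forall_mem hK'.measurableSet fun w hw => ?_
      have him : 0 < w.im := hK'U hw
      show ‖Real.log (‖F w‖ ^ 2 * w.im ^ 2)‖ ≤ 2 * ‖Real.log ‖F w‖‖ + 2 * ‖Real.log w.im‖
      simp only [Real.norm_eq_abs]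
      by_cases hFw : ‖F w‖ = 0
      · rw [hFw, zero_pow two_ne_zero, zero_mul, Real.log_zero, abs_zero]
        positivity
      · rw [Real.log_mul (pow_ne_zero _ hFw) (pow_ne_zero _ him.ne'), Real.log_pow, Real.log_pow]
        push_cast
        calc |2 * Real.log ‖F w‖ + 2 * Real.log w.im|
            ≤ |2 * Real.log ‖F w‖| + |2 * Real.log w.im| := abs_add_le _ _
          _ = 2 * |Real.log ‖F w‖| + 2 * |Real.log w.im| := by
              rw [abs_mul, abs_mul, abs_two]
  -- transfer to `ℍ`
  have hKm : MeasurableSet K := hK.measurableSet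
  have hcont : Continuous fun z : ℍ => ‖f z‖ ^ 2 * z.im ^ 2 :=
    ((hf.continuous.norm).pow 2).mul (UpperHalfPlane.continuous_im.pow 2)
  have humeas : Measurable fun z : ℍ => Real.log (‖f z‖ ^ 2 * z.im ^ 2) :=
    Real.measurable_log.comp hcont.measurable
  refine ⟨humeas.aestronglyMeasurable, ?_⟩
  -- a lower bound for `im` on `K`
  obtain ⟨δ, hδ, hδK⟩ : ∃ δ : ℝ, 0 < δ ∧ ∀ τ ∈ K, δ ≤ τ.im := by
    rcases K.eq_empty_or_nonempty with hKe | hKne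
    · exact ⟨1, one_pos, fun τ hτ => by simp [hKe] at hτ⟩
    · obtain ⟨τ₀, hτ₀, hmin⟩ := hK.exists_isMinOn hKne UpperHalfPlane.continuous_im.continuousOn
      exact ⟨τ₀.im, τ₀.im_pos, fun τ hτ => hmin hτ⟩
  rw [HasFiniteIntegral,
    Literature.NumberTheory.EllipticCurves.ModularForms.setLIntegral_eq_setLIntegral_image_coe hKm
      humeas.enorm]
  have hden : ∀ z ∈ K', (((1 / ‖z.im‖₊) ^ 2 : NNReal) : ENNReal) *
      ‖Real.log (‖f (UpperHalfPlane.ofComplex z)‖ ^ 2 * (UpperHalfPlane.ofComplex z).im ^ 2)‖ₑ ≤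
      ENNReal.ofReal ((1 / δ) ^ 2) * ‖Real.log (‖F z‖ ^ 2 * z.im ^ 2)‖ₑ := by
    rintro _ ⟨τ, hτ, rfl⟩
    rw [UpperHalfPlane.ofComplex_apply, hFdef, Function.comp_apply, UpperHalfPlane.ofComplex_apply,
      UpperHalfPlane.coe_im]
    refine mul_le_mul' ?_ le_rfl
    rw [← ENNReal.ofReal_coe_nnreal]
    refine ENNReal.ofReal_le_ofReal ?_
    push_cast
    have h1 : δ ≤ ‖τ.im‖ := by
      rw [Real.norm_eq_abs]
      exact (hδK τ hτ).trans (le_abs_self _)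
    have h2 : 1 / ‖τ.im‖ ≤ 1 / δ := one_div_le_one_div_of_le hδ h1
    simpa using pow_le_pow_left₀ (by positivity) h2 2
  calc ∫⁻ z in K', (((1 / ‖z.im‖₊) ^ 2 : NNReal) : ENNReal) *
        ‖Real.log (‖f (UpperHalfPlane.ofComplex z)‖ ^ 2 * (UpperHalfPlane.ofComplex z).im ^ 2)‖ₑ
      ≤ ∫⁻ z in K', ENNReal.ofReal ((1 / δ) ^ 2) * ‖Real.log (‖F z‖ ^ 2 * z.im ^ 2)‖ₑ :=
        setLIntegral_mono' hK'.measurableSet hden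
    _ = ENNReal.ofReal ((1 / δ) ^ 2) * ∫⁻ z in K', ‖Real.log (‖F z‖ ^ 2 * z.im ^ 2)‖ₑ :=
        lintegral_const_mul' _ _ ENNReal.ofReal_ne_top
    _ < ⊤ := ENNReal.mul_lt_top ENNReal.ofReal_lt_top hUint.2

end LogIntegrable

/-! ### The discharge -/

open Literature.NumberTheory.EllipticCurves.ModularForms (countable_setOf_cuspForm_eq_zero)

/-- **Discharge** of `shimuraCurve_pet_pos_ae_and_log_integrable`: for `D > 1`, a Shimura curve
datum `X` of level `(D, M)` and a non-zero `h ∈ S₂(Γ₀^D(M))`, `|h(z)|² (Im z)² > 0` for a.e.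
`z ∈ X.fd`, and `log(|h(z)|² (Im z)²)` is integrable on `X.fd` for the hyperbolic measure.
Proof: (i) the zeros of `h ≢ 0` are countable (isolated), hence null; (ii) `|h|² y²` is
`Γ`-invariant in weight `2` (Mathlib `slash_action_eqn''`, `im_smul_eq_div_normSq`); (iii) `Γ` is
cocompact for `D > 1` (tree `exists_forall_exists_smul_mem_closedBall`: `X.B` is a division
algebra, Minkowski, finiteness modulo `O¹` — the statement of Vignéras IV Thm. 1.1);
(iv) `log(|h|² y²)` is integrable on the compact `K` with `Γ K = ℍ`
(`integrableOn_log_normSq_mul_im_sq_of_isCompact`, Ransford Thm. 2.5.1 for `log |h|`); (v) by the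
unfolding identity over the fundamental domain (`setLIntegral_tsum_smul_eq`, tree),
`∫_{fd} |u| ≤ ∫_{fd} Σ_γ 𝟙_K(γw)|u(γ w)| = 2 ∫_K |u| < ∞` for the invariant `u = log(|h|² y²)`.
[cite: VignerasLNM800, Ch. IV §1 Thm. 1.1 (PDF p. 89)] [cite: Ransford1995, Thm. 2.2.2 (PDF p. 24) and Thm. 2.5.1 (PDF p. 33)] -/
theorem shimuraCurve_pet_pos_ae_and_log_integrable_holds :
    shimuraCurve_pet_pos_ae_and_log_integrable := by
  intro D M X h hD hh
  have hcoe : (⇑h : ℍ → ℂ) ≠ 0 := fun h0 => hh (DFunLike.ext' (by simpa using h0))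
  have hzero : volume {z : ℍ | h z = 0} = 0 :=
    measure_zero_of_countable (countable_setOf_cuspForm_eq_zero h hcoe)
  constructor
  · -- (i) a.e. positivity
    refine ae_restrict_of_ae ?_
    rw [ae_iff]
    refine measure_mono_null (fun z hz => ?_) hzero
    simp only [Set.mem_setOf_eq, not_lt] at hz ⊢
    by_contra hne
    have : 0 < ‖h z‖ ^ 2 * z.im ^ 2 := by
      have h1 : 0 < ‖h z‖ := norm_pos_iff.mpr hne
      have h2 : 0 < z.im := z.im_pos
      positivity
    exact absurd hz (not_le.mpr this)
  · -- (ii)–(v) integrability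
    obtain ⟨ρ, hcov⟩ := X.exists_forall_exists_smul_mem_closedBall hD
    set K : Set ℍ := Metric.closedBall UpperHalfPlane.I ρ with hKdef
    have hK : IsCompact K := isCompact_closedBall _ _
    set u : ℍ → ℝ := fun z => Real.log (‖h z‖ ^ 2 * z.im ^ 2) with hu
    -- (ii) invariance
    have hinv : ∀ γ ∈ X.Gamma, ∀ z : ℍ, u (γ • z) = u z := by
      intro γ hγ z
      simp only [hu]
      congr 1
      have hden : UpperHalfPlane.denom γ z ≠ 0 := UpperHalfPlane.denom_ne_zero γ z
      have hdet : (γ.det : ℝˣ) = 1 := Subgroup.HasDetOne.det_eq hγ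
      have hdetv : (γ.det : ℝˣ).val = 1 := by rw [hdet, Units.val_one]
      rw [SlashInvariantForm.slash_action_eqn'' h hγ z, UpperHalfPlane.im_smul_eq_div_normSq γ z,
        hdetv, abs_one, one_mul, norm_mul, norm_zpow, Complex.normSq_eq_norm_sq]
      have hn : ‖UpperHalfPlane.denom γ z‖ ≠ 0 := norm_ne_zero_iff.mpr hden
      field_simp
    -- (iv) integrability on `K`
    have hKint : IntegrableOn u K volume :=
      integrableOn_log_normSq_mul_im_sq_of_isCompact (CuspFormClass.holo h) hcoe hK
    -- (v) transfer to the fundamental domain by unfolding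
    have hcont : Continuous fun z : ℍ => ‖h z‖ ^ 2 * z.im ^ 2 :=
      (((CuspFormClass.holo h).continuous.norm).pow 2).mul (UpperHalfPlane.continuous_im.pow 2)
    have humeas : Measurable u := Real.measurable_log.comp hcont.measurable
    refine ⟨humeas.aestronglyMeasurable, ?_⟩
    have hKm : MeasurableSet K := hK.measurableSet
    set φ : ℍ → ENNReal := fun w => K.indicator (fun _ => (1 : ENNReal)) w * ‖u w‖ₑ with hφ
    have hφm : AEMeasurable φ volume :=
      ((measurable_const.indicator hKm).mul humeas.enorm).aemeasurable
    have hunf := setLIntegral_tsum_smul_eq X.Gamma_le_range_toGL X.neg_one_mem_Gamma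
      X.countable_Gamma X.isHypFundamentalDomain_fd hφm
    have hφint : ∫⁻ w, φ w = ∫⁻ w in K, ‖u w‖ₑ := by
      rw [← lintegral_indicator hKm]
      refine lintegral_congr fun w => ?_
      simp only [hφ]
      by_cases hw : w ∈ K
      · rw [Set.indicator_of_mem hw, Set.indicator_of_mem hw, one_mul]
      · rw [Set.indicator_of_notMem hw, Set.indicator_of_notMem hw, zero_mul]
    have hpt : ∀ w : ℍ, ‖u w‖ₑ ≤ ∑' γ : X.Gamma, φ ((γ : GL (Fin 2) ℝ) • w) := by
      intro w
      obtain ⟨γ₀, hγ₀, hγ₀K⟩ := hcov w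
      calc ‖u w‖ₑ = φ ((⟨γ₀, hγ₀⟩ : X.Gamma) • w) := by
            show ‖u w‖ₑ = φ (γ₀ • w)
            simp only [hφ]
            rw [Set.indicator_of_mem hγ₀K, one_mul, hinv γ₀ hγ₀ w]
        _ ≤ ∑' γ : X.Gamma, φ ((γ : GL (Fin 2) ℝ) • w) :=
            ENNReal.le_tsum (f := fun γ : X.Gamma => φ ((γ : GL (Fin 2) ℝ) • w)) ⟨γ₀, hγ₀⟩
    rw [HasFiniteIntegral]
    calc ∫⁻ w in X.fd, ‖u w‖ₑ ≤ ∫⁻ w in X.fd, ∑' γ : X.Gamma, φ ((γ : GL (Fin 2) ℝ) • w) :=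
          lintegral_mono hpt
      _ = 2 * ∫⁻ w, φ w := hunf
      _ = 2 * ∫⁻ w in K, ‖u w‖ₑ := by rw [hφint]
      _ < ⊤ := ENNReal.mul_lt_top (by simp) hKint.2

end Literature.NumberTheory.Automorphic
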